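import Literature.NumberTheory.ConnesConsani2021.ProlateProjections
import Mathlib.Analysis.SpecialFunctions.Stirling
import Mathlib.Analysis.SpecialFunctions.Gamma.Beta
import Mathlib.Analysis.SpecialFunctions.Complex.LogBounds
import HarnessLib

/-!
# Connes–Consani 2021, §4 (rapid-decay): the Stirling asymptotics of the Rokhlin–Xiao bound

RH-FREE (label, line 1).  Companion (theorems only, no definition, no named fact) of
`Literature/NumberTheory/ConnesConsani2021/ProlateProjections.lean` (A. Connes, C. Consani, *Weil
positivity and trace formula, the archimedean place*, Selecta Math. 27 (2021) = arXiv:2006.13771, §4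
display (rapid-decay), p. 16 [cite: ConnesConsani2021, §4 p. 16 eq. (rapid-decay) (arXiv p0016:L34–L37)]).

The named fact `CC2021_sec4_rapidDecay` of that file is the CONJUNCTION of
(1) the analytic input "`|λ(n)| ≤ 2^{2n}π^{2n+1/2}((2n)!)²/((4n)!Γ(2n+3/2))` for all `n`"
    (Rokhlin–Xiao 2007 Thm. 14, stated there for `m = 2n` large; a FROZEN boundary fact of the cell), and
(2) the printed asymptotics "`∼ (4n+1)^{−2n−1/2}(eπ)^{2n+1/2}`" of that bound, which is a Stirling
    computation.
This file PROVES (2) (`isEquivalent_rokhlinXiaoBound`) and records the typed reduction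
`CC2021_sec4_rapidDecay_of_abs_le : (1) → CC2021_sec4_rapidDecay`, so that the named fact is reduced to its
analytic clause alone (cell rh-crit R54 (4a); the boundary is one printed inequality, not two statements).

Route (all elementary): Legendre duplication `Γ(2n+1)Γ(2n+3/2) = Γ(4n+2)2^{−4n−1}√π`
(`Real.Gamma_mul_Gamma_add_half`) gives the square-root-free closed form
`rokhlinXiaoBound n = 2^{6n+1}π^{2n}((2n)!)³/((4n)!(4n+1)!)`; Stirling (`Stirling.factorial_isEquivalent_stirling`,
squared and composed with `k = 2n, 4n, 4n+1`) gives
`rokhlinXiaoBound² ∼ π^{4n+1}e^{4n+2}(4n)^{4n+2}/(4n+1)^{8n+3}`, whose ratio to the square of the printed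
right-hand side `(eπ)^{4n+1}/(4n+1)^{4n+1}` is `e·(1 − 1/(4n+1))^{4n+2} → 1`
(`Real.tendsto_one_add_div_pow_exp`); both sides being positive, the squares may be removed.
Nothing here bears on the truth of the Riemann hypothesis; nothing here bounds `λ(n)` itself.
-/

noncomputable section

open Filter Asymptotics Topology
open scoped Real Nat

namespace Literature.NumberTheory.ConnesConsani2021

/-! ## §1 The Gamma factor and the square-root-free closed form of the bound -/

/-- `Γ(2n + 3/2) = (4n+1)! √π / (2^{4n+1} (2n)!)` (Legendre duplication at `s = 2n+1`). [folklore] -/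
private theorem Real_Gamma_two_mul_add_three_halves (n : ℕ) :
    Real.Gamma (2 * n + 3 / 2) =
      ((4 * n + 1)! : ℝ) * Real.sqrt π / (2 ^ (4 * n + 1) * (2 * n)!) := by
  have h := Real.Gamma_mul_Gamma_add_half (2 * n + 1)
  have h1 : Real.Gamma (2 * (n : ℝ) + 1) = (2 * n)! := by
    exact_mod_cast Real.Gamma_nat_eq_factorial (2 * n)
  have h2 : Real.Gamma (2 * (2 * (n : ℝ) + 1)) = (4 * n + 1)! := by
    have := Real.Gamma_nat_eq_factorial (4 * n + 1)
    rw [show (2 * (2 * (n : ℝ) + 1)) = ((4 * n + 1 : ℕ) : ℝ) + 1 by push_cast; ring]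
    exact this
  have h3 : (2 : ℝ) ^ (1 - 2 * (2 * (n : ℝ) + 1)) = (2 ^ (4 * n + 1))⁻¹ := by
    rw [show (1 - 2 * (2 * (n : ℝ) + 1)) = -((4 * n + 1 : ℕ) : ℝ) by push_cast; ring,
      Real.rpow_neg zero_le_two, Real.rpow_natCast]
  rw [h1, h2, h3, show (2 * (n : ℝ) + 1 + 1 / 2) = 2 * n + 3 / 2 by ring] at h
  have hf : ((2 * n)! : ℝ) ≠ 0 := by positivity
  have hp : (2 : ℝ) ^ (4 * n + 1) ≠ 0 := by positivity
  field_simp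
  field_simp at h
  linarith [h]

/-- **The bound without square roots**: `2^{2n}π^{2n+1/2}((2n)!)²/((4n)!Γ(2n+3/2)) =
2^{6n+1}π^{2n}((2n)!)³/((4n)!(4n+1)!)`. [cite: ConnesConsani2021, §4 p. 16 eq. (rapid-decay) (arXiv p0016:L34–L37)] -/
theorem rokhlinXiaoBound_eq (n : ℕ) :
    rokhlinXiaoBound n =
      2 ^ (6 * n + 1) * π ^ (2 * n) * ((2 * n)! : ℝ) ^ 3 / ((4 * n)! * (4 * n + 1)!) := by
  rw [rokhlinXiaoBound, Real_Gamma_two_mul_add_three_halves]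
  have hsqrt : Real.sqrt π ≠ 0 := (Real.sqrt_pos.2 Real.pi_pos).ne'
  have hf2 : ((2 * n)! : ℝ) ≠ 0 := by positivity
  have hf4 : ((4 * n)! : ℝ) ≠ 0 := by positivity
  have hf41 : ((4 * n + 1)! : ℝ) ≠ 0 := by positivity
  have hp : (2 : ℝ) ^ (4 * n + 1) ≠ 0 := by positivity
  field_simp
  ring

/-- The bound is positive. [cite: ConnesConsani2021, §4 p. 16 eq. (rapid-decay)] -/
theorem rokhlinXiaoBound_pos (n : ℕ) : 0 < rokhlinXiaoBound n := by
  rw [rokhlinXiaoBound_eq]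
  positivity

/-! ## §2 Stirling, squared and composed -/

/-- Stirling squared: `(k!)² ∼ 2πk (k/e)^{2k}`. [folklore] -/
private theorem factorial_sq_isEquivalent :
    (fun k : ℕ ↦ ((k ! : ℝ)) ^ 2) ~[atTop]
      fun k : ℕ ↦ 2 * (k : ℝ) * π * (k : ℝ) ^ (2 * k) / Real.exp 1 ^ (2 * k) := by
  have h := (Stirling.factorial_isEquivalent_stirling).pow 2
  refine h.congr_right (Eventually.of_forall fun k ↦ ?_)
  simp only [Pi.pow_apply]
  rw [mul_pow, Real.sq_sqrt (by positivity), ← pow_mul, div_pow]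
  ring

/-- Stirling squared along `k = a n + b` (`a ≥ 1`). [folklore] -/
private theorem factorial_sq_isEquivalent_comp (a b : ℕ) (ha : 1 ≤ a) :
    (fun n : ℕ ↦ (((a * n + b) ! : ℝ)) ^ 2) ~[atTop]
      fun n : ℕ ↦ 2 * ((a * n + b : ℕ) : ℝ) * π * ((a * n + b : ℕ) : ℝ) ^ (2 * (a * n + b)) /
        Real.exp 1 ^ (2 * (a * n + b)) := by
  have ht : Tendsto (fun n : ℕ ↦ a * n + b) atTop atTop :=
    tendsto_atTop_mono (fun n : ℕ ↦ show n ≤ a * n + b by nlinarith) tendsto_id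
  exact factorial_sq_isEquivalent.comp_tendsto ht

/-! ## §3 The asymptotic equivalence (rapid-decay), second clause -/

/-- The square of the bound is asymptotic to `π^{4n+1} e^{4n+2} (4n)^{4n+2} / (4n+1)^{8n+3}`.
[cite: ConnesConsani2021, §4 p. 16 eq. (rapid-decay) (arXiv p0016:L34–L37)] -/
theorem rokhlinXiaoBound_sq_isEquivalent :
    (fun n : ℕ ↦ rokhlinXiaoBound n ^ 2) ~[atTop]
      fun n : ℕ ↦ π ^ (4 * n + 1) * Real.exp 1 ^ (4 * n + 2) * (4 * (n : ℝ)) ^ (4 * n + 2) /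
        (4 * (n : ℝ) + 1) ^ (8 * n + 3) := by
  have he : Real.exp 1 ≠ 0 := (Real.exp_pos 1).ne'
  -- the three Stirling inputs, with all symbolic-exponent numerals written in base `4`
  -- (`ring` does not identify `2 ^ (2k)` with `4 ^ k` for symbolic `k`)
  have hA : (fun n : ℕ ↦ (((2 * n) ! : ℝ)) ^ 2) ~[atTop]
      fun n : ℕ ↦ 4 * (n : ℝ) * π * (4 * (n : ℝ) ^ 2) ^ (2 * n) / Real.exp 1 ^ (4 * n) := by
    refine (factorial_sq_isEquivalent_comp 2 0 (by norm_num)).congr_right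
      (Eventually.of_forall fun n ↦ ?_)
    simp only [add_zero]
    push_cast
    rw [show (2 * (n : ℝ)) ^ (2 * (2 * n)) = (4 * (n : ℝ) ^ 2) ^ (2 * n) by
      rw [pow_mul, show (2 * (n : ℝ)) ^ 2 = 4 * (n : ℝ) ^ 2 by ring],
      show 2 * (2 * n) = 4 * n by ring]
    ring
  have hB : (fun n : ℕ ↦ (((4 * n) ! : ℝ)) ^ 2) ~[atTop]
      fun n : ℕ ↦ 8 * (n : ℝ) * π * (4 * (n : ℝ)) ^ (8 * n) / Real.exp 1 ^ (8 * n) := by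
    refine (factorial_sq_isEquivalent_comp 4 0 (by norm_num)).congr_right
      (Eventually.of_forall fun n ↦ ?_)
    simp only [add_zero]
    push_cast
    rw [show 2 * (4 * n) = 8 * n by ring]
    ring
  have hC : (fun n : ℕ ↦ (((4 * n + 1) ! : ℝ)) ^ 2) ~[atTop]
      fun n : ℕ ↦ 2 * (4 * (n : ℝ) + 1) * π * (4 * (n : ℝ) + 1) ^ (8 * n + 2) /
        Real.exp 1 ^ (8 * n + 2) := by
    refine (factorial_sq_isEquivalent_comp 4 1 (by norm_num)).congr_right
      (Eventually.of_forall fun n ↦ ?_)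
    push_cast
    rw [show 2 * (4 * n + 1) = 8 * n + 2 by ring]
  -- the prefactor `(2^{6n+1} π^{2n})² = (2 · 4^{3n} π^{2n})²`
  have h64 : ∀ n : ℕ, (2 : ℝ) ^ (6 * n + 1) = 2 * 4 ^ (3 * n) := fun n ↦ by
    rw [pow_succ, show 6 * n = 2 * (3 * n) by ring, pow_mul]
    norm_num
    ring
  have hc : (fun n : ℕ ↦ ((2 : ℝ) * 4 ^ (3 * n) * π ^ (2 * n)) ^ 2) ~[atTop]
      fun n : ℕ ↦ ((2 : ℝ) * 4 ^ (3 * n) * π ^ (2 * n)) ^ 2 := IsEquivalent.refl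
  have h := (hc.mul (hA.pow 3)).div (hB.mul hC)
  have hL : (fun n : ℕ ↦ rokhlinXiaoBound n ^ 2) =
      (fun n : ℕ ↦ ((2 : ℝ) * 4 ^ (3 * n) * π ^ (2 * n)) ^ 2) *
          (fun n : ℕ ↦ (((2 * n) ! : ℝ)) ^ 2) ^ 3 /
        ((fun n : ℕ ↦ (((4 * n) ! : ℝ)) ^ 2) * fun n : ℕ ↦ (((4 * n + 1) ! : ℝ)) ^ 2) := by
    funext n
    simp only [Pi.mul_apply, Pi.div_apply, Pi.pow_apply]
    rw [rokhlinXiaoBound_eq, h64]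
    have hf4 : ((4 * n)! : ℝ) ≠ 0 := by positivity
    have hf41 : ((4 * n + 1)! : ℝ) ≠ 0 := by positivity
    field_simp
  rw [hL]
  refine h.trans ?_
  refine IsEquivalent.congr_left IsEquivalent.refl ?_
  -- exact algebra: the Stirling right-hand sides combine to the stated expression
  refine Eventually.of_forall fun n ↦ ?_
  simp only [Pi.mul_apply, Pi.div_apply, Pi.pow_apply]
  rcases Nat.eq_zero_or_pos n with rfl | hn
  · simp
  have hn' : (n : ℝ) ≠ 0 := by exact_mod_cast hn.ne'
  have h41 : (4 * (n : ℝ) + 1) ≠ 0 := by positivity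
  field_simp
  ring

/-- The ratio of the two squared asymptotics tends to `1`:
`e · (4n/(4n+1))^{4n+2} → 1`. [folklore] -/
private theorem tendsto_exp_mul_ratio_pow :
    Tendsto (fun n : ℕ ↦ Real.exp 1 * (4 * (n : ℝ)) ^ (4 * n + 2) / (4 * (n : ℝ) + 1) ^ (4 * n + 2))
      atTop (𝓝 1) := by
  -- `(1 + (-1)/(4n+1))^{4n+1} → e^{-1}` along `4n+1 → ∞`
  have ht : Tendsto (fun n : ℕ ↦ 4 * n + 1) atTop atTop :=
    tendsto_atTop_mono (fun n : ℕ ↦ show n ≤ 4 * n + 1 by omega) tendsto_id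
  have h1 : Tendsto (fun n : ℕ ↦ (1 + (-1 : ℝ) / ((4 * n + 1 : ℕ) : ℝ)) ^ (4 * n + 1)) atTop
      (𝓝 (Real.exp (-1))) :=
    (Real.tendsto_one_add_div_pow_exp (-1)).comp ht
  -- `4n/(4n+1) → 1`
  have h2 : Tendsto (fun n : ℕ ↦ (4 * (n : ℝ)) / (4 * n + 1)) atTop (𝓝 1) := by
    have e : (fun n : ℕ ↦ (4 * (n : ℝ)) / (4 * n + 1)) = fun n : ℕ ↦ 1 - 1 / (4 * (n : ℝ) + 1) := by
      funext n
      have : (4 * (n : ℝ) + 1) ≠ 0 := by positivity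
      field_simp
      ring
    rw [e]
    have h3 : Tendsto (fun n : ℕ ↦ 4 * (n : ℝ) + 1) atTop atTop := by
      refine tendsto_atTop_add_const_right _ _ ?_
      exact tendsto_natCast_atTop_atTop.const_mul_atTop (by norm_num)
    have h4 : Tendsto (fun n : ℕ ↦ 1 / (4 * (n : ℝ) + 1)) atTop (𝓝 0) :=
      tendsto_const_nhds.div_atTop h3
    simpa using (tendsto_const_nhds (x := (1 : ℝ))).sub h4
  have h := (h1.mul h2).const_mul (Real.exp 1)
  have hlim : Real.exp 1 * (Real.exp (-1) * 1) = 1 := by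
    rw [mul_one, ← Real.exp_add]; simp
  rw [hlim] at h
  refine h.congr fun n ↦ ?_
  have h41 : (4 * (n : ℝ) + 1) ≠ 0 := by positivity
  have e1 : (1 + (-1 : ℝ) / ((4 * n + 1 : ℕ) : ℝ)) = (4 * (n : ℝ)) / (4 * n + 1) := by
    push_cast
    field_simp
    ring
  rw [e1]
  simp only [div_pow]
  field_simp
  ring

/-- Un-squaring an asymptotic equivalence of positive sequences. [folklore] -/
private theorem isEquivalent_of_sq {u v : ℕ → ℝ} (hu : ∀ n, 0 < u n) (hv : ∀ n, 0 < v n)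
    (h : (fun n ↦ u n ^ 2) ~[atTop] fun n ↦ v n ^ 2) : u ~[atTop] v := by
  have hv2 : ∀ᶠ n in atTop, v n ^ 2 ≠ 0 := Eventually.of_forall fun n ↦ (pow_pos (hv n) 2).ne'
  have hv1 : ∀ᶠ n in atTop, v n ≠ 0 := Eventually.of_forall fun n ↦ (hv n).ne'
  rw [isEquivalent_iff_tendsto_one hv2] at h
  rw [isEquivalent_iff_tendsto_one hv1]
  have hs := (Real.continuous_sqrt.tendsto 1).comp h
  rw [Real.sqrt_one] at hs
  refine hs.congr fun n ↦ ?_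
  simp only [Function.comp_apply, Pi.div_apply]
  rw [← div_pow, Real.sqrt_sq (div_pos (hu n) (hv n)).le]

/-- **(rapid-decay), second clause, PROVED**: `2^{2n}π^{2n+1/2}((2n)!)²/((4n)!Γ(2n+3/2))
∼ (4n+1)^{−2n−1/2}(eπ)^{2n+1/2}` as `n → ∞` (Stirling). [cite: ConnesConsani2021, §4 p. 16 eq. (rapid-decay) (arXiv p0016:L34–L37)] -/
theorem isEquivalent_rokhlinXiaoBound :
    Asymptotics.IsEquivalent atTop rokhlinXiaoBound
      (fun n : ℕ ↦ (4 * n + 1 : ℝ) ^ (-(2 * n + 1 / 2 : ℝ)) * (Real.exp 1 * π) ^ (2 * n + 1 / 2 : ℝ)) := by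
  set T : ℕ → ℝ := fun n ↦ (4 * n + 1 : ℝ) ^ (-(2 * n + 1 / 2 : ℝ)) *
    (Real.exp 1 * π) ^ (2 * n + 1 / 2 : ℝ) with hT
  have hTpos : ∀ n, 0 < T n := fun n ↦
    mul_pos (Real.rpow_pos_of_pos (by positivity) _) (Real.rpow_pos_of_pos (by positivity) _)
  -- `T n ^ 2 = (eπ)^{4n+1}/(4n+1)^{4n+1}`
  have hT2 : ∀ n : ℕ, T n ^ 2 = (Real.exp 1 * π) ^ (4 * n + 1) / (4 * (n : ℝ) + 1) ^ (4 * n + 1) := by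
    intro n
    have h41 : (0 : ℝ) ≤ 4 * n + 1 := by positivity
    have hep : (0 : ℝ) ≤ Real.exp 1 * π := by positivity
    have e2 : ((2 * n + 1 / 2 : ℝ)) * 2 = ((4 * n + 1 : ℕ) : ℝ) := by push_cast; ring
    simp only [hT]
    rw [mul_pow, ← Real.rpow_mul_natCast h41, ← Real.rpow_mul_natCast hep]
    push_cast
    rw [neg_mul, e2, Real.rpow_neg h41, Real.rpow_natCast, Real.rpow_natCast]
    ring
  refine isEquivalent_of_sq rokhlinXiaoBound_pos hTpos ?_
  refine rokhlinXiaoBound_sq_isEquivalent.trans ?_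
  -- `S ∼ T²` since `S/T² = e (4n/(4n+1))^{4n+2} → 1`
  have hv : ∀ᶠ n : ℕ in atTop, T n ^ 2 ≠ 0 := Eventually.of_forall fun n ↦ (pow_pos (hTpos n) 2).ne'
  rw [isEquivalent_iff_tendsto_one hv]
  refine tendsto_exp_mul_ratio_pow.congr fun n ↦ ?_
  simp only [Pi.div_apply]
  rw [hT2 n]
  have he : Real.exp 1 ≠ 0 := (Real.exp_pos 1).ne'
  have h41 : (4 * (n : ℝ) + 1) ≠ 0 := by positivity
  field_simp
  ring

/-! ## §4 The named fact reduced to its analytic clause -/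

/-- **(rapid-decay) from its first clause**: the bound `|λ(n)| ≤ 2^{2n}π^{2n+1/2}((2n)!)²/((4n)!Γ(2n+3/2))`
for all `n` (the analytic input, Rokhlin–Xiao Thm. 14) implies the named fact `CC2021_sec4_rapidDecay`,
the asymptotic clause being the theorem `isEquivalent_rokhlinXiaoBound`.
[cite: ConnesConsani2021, §4 p. 16 eq. (rapid-decay) (arXiv p0016:L34–L37); RokhlinXiao2007, Thm. 14 p. 117] -/
theorem CC2021_sec4_rapidDecay_of_abs_le (h : ∀ n : ℕ, |prolateEigen n| ≤ rokhlinXiaoBound n) :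
    CC2021_sec4_rapidDecay :=
  ⟨h, isEquivalent_rokhlinXiaoBound⟩

/-- Conversely the named fact contains the analytic clause (so the two are equivalent).
[cite: ConnesConsani2021, §4 p. 16 eq. (rapid-decay)] -/
theorem CC2021_sec4_rapidDecay_iff_abs_le :
    CC2021_sec4_rapidDecay ↔ ∀ n : ℕ, |prolateEigen n| ≤ rokhlinXiaoBound n :=
  ⟨fun h ↦ h.1, CC2021_sec4_rapidDecay_of_abs_le⟩

end Literature.NumberTheory.ConnesConsani2021
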